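import Summits.BirchSwinnertonDyer.BirchSwinnertonDyer.Theorems.PrintCFramBottomClassIndexLawFiveLeBorelFrobeniusNonScalar
import Summits.BirchSwinnertonDyer.BirchSwinnertonDyer.Theorems.PrintCFramBottomClassIndexLawFiveLeEisensteinTraceForm
import Summits.BirchSwinnertonDyer.BirchSwinnertonDyer.Theorems.QuadraticBranchSignedControlPlusEtaNonsurjUncongruentFineTools
import Literature.NumberTheory.EllipticCurves.RationalIsogenyFrobeniusCertificatesCM
import Literature.NumberTheory.EllipticCurves.RationalIsogenyFrobeniusCertificates11
import Literature.NumberTheory.EllipticCurves.RationalIsogenyFrobeniusCertificates19and37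
import HarnessLib

/-!
# Route `PrintCFram`, crux C2 `BottomClassIndexLawFiveLe` (stmt-BirchSwinnertonDyer-20372), line
# `eisenstein-resource-bdp-line` (S2 `stub_kolyvaginUpper_borelCM`, input hCe): **a Galois element FIXING
# `√−p` and acting NON-SCALARLY on `W[p]`, for every member of the Borel CM-ramified class**
# (cell `bsd-print-cfram`, seat `bsd-line-cfram-p1-w4` g3; helper `--supports` 20372; 0 facts, 0 defs)

HONEST FRAMING. Nothing about BSD is proved here, and nothing of S2 itself. This is the leaf half of
the input «hCe» of the tree's Kolyvagin machine at the Borel prime (the scalar commutant of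
`ρ̄_{W,p}(Γ_{K''})`, `KolyvaginImage.exists_eq_zsmul`, Gross 1991 proof of Prop. 9.3; assembled in the
sequel `…BorelScalarCommutant.lean`): `ρ̄_{W,p}(Γ_{ℚ(√−p)})` is NOT contained in the scalars `𝔽_pˣ` —
equivalently the Borel image has a non-trivial unipotent part and `W[p]` is a NON-SEMISIMPLE
`Γ_ℚ`-module (its only `Γ_ℚ`-stable line is `W[𝔭]`). Two earlier seats sized this «L» expecting the
local CM / Lubin–Tate tower; it is M through Frobenius traces modulo `p²`.

MECHANISM (no CM main theorem, no Lubin–Tate, no Chebotarev; kit 0).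
* §1 LEAF DATA: one kernel point count per base curve — `#Ẽ(𝔽_q)` for
  `(49a1, q = 11) = 8`, `([1,−1,0,−37,−78] (j = 16581375, N = 49), 11) = 8`, `(121b1, 3) = 5`, `(361a1, 5) = 7`,
  `(1849a1, 11) = 13`, `(4489a1, 17) = 19`, `(26569a1, 41) = 43` — so `a_q = 4, 4, −1, −1, −1, −1, −1`
  and **`a_q² − 4q = −28, −28, −11, −19, −43, −67, −163` is NOT divisible by `p²`**; `q` is chosen
  SPLIT in `ℚ(√−p)` (`−p` a square mod `q`; `41 = (1 + 163)/4` is the least such prime at `163`).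
  The `j = 16581375` base `[1,−1,0,−37,−78]` (CM by `ℤ[√−7]`, `N = 49`; elliptic / `j` / globally minimal
  are the tree's `EtaUncongruentRecords.isElliptic_A7b`, `j_A7b`, `isGloballyMinimal_A7b`) gets its good reduction
  away from `7` and `a₁₁ = 4` here; the other five point counts are the tree's Kenku-level certificates
  (`KenkuLevelsCert.card_E11_jm32768_3`, `…_E19_…_5`, `…_E43_…_11`, `…_E67_…_17`, `…_E163_…_41`).
* §2 THE NON-SCALAR FROBENIUS (`exists_frobenius_nonScalar_of_cmRamified`): for every elliptic `W/ℚ`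
  with CM, `p ≥ 5` ramified in the CM field, and every `s = √−p ∈ ℚ̄`, there is `σ ∈ Γ_ℚ` FIXING `s`
  with `∀ c : ℤ, ∃ Q ∈ W[p], σ•Q ≠ c•Q`: the arithmetic Frobenius `σ_q` of the base curve fixes `√−p`
  (`q` split; the tree's `DeuringLadic.smul_eq_self_of_isArithFrobAt`, Euler's criterion), is
  non-scalar on the base curve's `p`-torsion by the GENERIC `BorelNonScalar.exists_smul_ne_of_not_sq_dvd`
  (a scalar Frobenius forces `p² ∣ a_q² − 4q`), and non-scalarity moves to every `W` with the same `j`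
  along the tree's `ℚ̄`-isomorphisms with a sign rule (`DeuringLadic.exists_iso_of_j_eq`, through the
  short models of the certificates `cert7, cert28, cert11, cert19, cert43, cert67, cert163`).

THEOREMS ONLY; no definition, no named fact, no `sorry`; imports no `Theses` module. BSD is not
proved by any of this; no summit statement is proved by this seat.
References: [SilvermanAEC2009] III.§7, C.21 Remark 21.3, X.5 Prop. 5.4; [Cremona1997] Table 1 (49a1,
121b1, 361a1, 1849a1, 4489a1, 26569a1: the `a_q`); [SilvermanATAEC1994] App. A §3 (CM
j-invariants); [GrossLMS1991] §9 (where the input is consumed).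
-/

set_option autoImplicit false
-- `…BirchSwinnertonDyer.BirchSwinnertonDyer.Theorems…` is the problem's mandated namespace (D-0017).
set_option linter.dupNamespace false

noncomputable section

open scoped Classical NumberField Matrix

namespace Summit.BirchSwinnertonDyer.BirchSwinnertonDyer.Theorems.PrintCFram.BorelNonScalar

open WeierstrassCurve Field IsDedekindDomain NumberField Rat.HeightOneSpectrum
  Literature.NumberTheory.EllipticCurves Literature.NumberTheory.GaloisRepresentations
  Literature.NumberTheory.EllipticCurves.PolyCert Literature.NumberTheory.EllipticCurves.CMIsogenyCert
  Literature.NumberTheory.EllipticCurves.Rank1Residual Summit.BirchSwinnertonDyer.Rank1Residual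
  Summit.BirchSwinnertonDyer.Rank1Residual.X12.O11
  Summit.BirchSwinnertonDyer.BirchSwinnertonDyer.Rank1Residual

/-! ## §1 Leaf data: one point count per base curve, `p² ∤ a_q² − 4q` -/

section LeafData

/-- `#Ẽ(𝔽₁₁) = 8` for `49a1 = [1, −1, 0, −2, −1]` (`a₁₁ = 4`; `11 = 2² + 7·1²` splits in `ℚ(√−7)`).
Kernel-decided. [cite: Cremona1997, Table 1 (49a1)] -/
theorem card_cm7_mod11 :
    Nat.card (((⟨1, -1, 0, -2, -1⟩ : WeierstrassCurve ℤ).map (Int.castRingHom (ZMod 11))).toAffine.Point) = 8 := by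
  rw [@natCard_point_eq_one_add_card (ZMod 11) (@ZMod.instField 11 ⟨by norm_num⟩) _ _ _
    (by decide +kernel), @card_sol_eq_sum_euler (ZMod 11) (@ZMod.instField 11 ⟨by norm_num⟩)
    _ _ (by rw [ZMod.ringChar_zmod_n]; decide), ZMod.card]
  decide +kernel

/-- `a₁₁(49a1) = 4`. [cite: Cremona1997, Table 1 (49a1)] -/
theorem frobeniusTrace_cm7_eleven :
    (haveI := RouteU.isGloballyMinimal_X049_eq; cm7.frobeniusTrace 11) = 4 := by
  haveI : cm7.IsGloballyMinimal := RouteU.isGloballyMinimal_X049_eq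
  have hI : integralModelInt cm7 = ⟨1, -1, 0, -2, -1⟩ :=
    IntModel.integralModelInt_eq_of_map_eq _ (IntModel.map_mk_int 1 (-1) 0 (-2) (-1))
  rw [IntModel.frobeniusTrace_eq hI card_cm7_mod11]
  norm_num

/-- `[1, −1, 0, −37, −78]` (`j = 16581375`, `N = 49`) has good reduction at every prime `ℓ ≠ 7` (`Δ_min = 7³`). [cite: Cremona1997, Table 1 (49a)] -/
theorem hasGoodReductionAtPrime_A7b (ℓ : ℕ) [hℓ : Fact ℓ.Prime] (h7 : ℓ ≠ 7) :
    (haveI := EtaUncongruentRecords.isElliptic_A7b; (⟨1, -1, 0, -37, -78⟩ : WeierstrassCurve ℚ).HasGoodReductionAtPrime ℓ) := by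
  haveI := EtaUncongruentRecords.isElliptic_A7b
  haveI : (⟨1, -1, 0, -37, -78⟩ : WeierstrassCurve ℚ).IsGloballyMinimal := EtaUncongruentRecords.isGloballyMinimal_A7b
  have hI : integralModelInt (⟨1, -1, 0, -37, -78⟩ : WeierstrassCurve ℚ) = ⟨1, -1, 0, -37, -78⟩ :=
    IntModel.integralModelInt_eq_of_map_eq _ (IntModel.map_mk_int 1 (-1) 0 (-37) (-78))
  have hmin : minimalDiscriminantInt (⟨1, -1, 0, -37, -78⟩ : WeierstrassCurve ℚ) = 343 := by
    rw [IntModel.minimalDiscriminantInt_eq hI]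
    simp only [WeierstrassCurve.Δ, WeierstrassCurve.b₂, WeierstrassCurve.b₄, WeierstrassCurve.b₆,
      WeierstrassCurve.b₈]
    norm_num
  refine hasGoodReductionAtPrime_of_not_dvd _ ℓ ?_
  rw [hmin, show (343 : ℤ) = 7 ^ 3 by norm_num]
  intro h
  have h' : (ℓ : ℤ) ∣ 7 := (Nat.prime_iff_prime_int.mp hℓ.out).dvd_of_dvd_pow h
  have h'' : ℓ ∣ 7 := by exact_mod_cast h'
  exact h7 ((Nat.prime_dvd_prime_iff_eq hℓ.out (by norm_num)).mp h'')

/-- `#Ẽ(𝔽₁₁) = 8` for `[1, −1, 0, −37, −78]` (`j = 16581375`; `a₁₁ = 4`, isogenous to `49a1`). Kernel-decided.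
[cite: Cremona1997, Table 1 (49a)] -/
theorem card_A7b_mod11 :
    Nat.card (((⟨1, -1, 0, -37, -78⟩ : WeierstrassCurve ℤ).map (Int.castRingHom (ZMod 11))).toAffine.Point) = 8 := by
  rw [@natCard_point_eq_one_add_card (ZMod 11) (@ZMod.instField 11 ⟨by norm_num⟩) _ _ _
    (by decide +kernel), @card_sol_eq_sum_euler (ZMod 11) (@ZMod.instField 11 ⟨by norm_num⟩)
    _ _ (by rw [ZMod.ringChar_zmod_n]; decide), ZMod.card]
  decide +kernel

/-- `a₁₁ = 4` for `[1, −1, 0, −37, −78]` (`j = 16581375`, `N = 49`). [cite: Cremona1997, Table 1 (49a)] -/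
theorem frobeniusTrace_A7b_eleven :
    (haveI := EtaUncongruentRecords.isElliptic_A7b; haveI := EtaUncongruentRecords.isGloballyMinimal_A7b;
      (⟨1, -1, 0, -37, -78⟩ : WeierstrassCurve ℚ).frobeniusTrace 11) = 4 := by
  haveI := EtaUncongruentRecords.isElliptic_A7b
  haveI : (⟨1, -1, 0, -37, -78⟩ : WeierstrassCurve ℚ).IsGloballyMinimal := EtaUncongruentRecords.isGloballyMinimal_A7b
  have hI : integralModelInt (⟨1, -1, 0, -37, -78⟩ : WeierstrassCurve ℚ) = ⟨1, -1, 0, -37, -78⟩ :=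
    IntModel.integralModelInt_eq_of_map_eq _ (IntModel.map_mk_int 1 (-1) 0 (-37) (-78))
  rw [IntModel.frobeniusTrace_eq hI card_A7b_mod11]
  norm_num

/-- `a₃(121b1) = −1`. [cite: Cremona1997, Table 1 (121b1)] -/
theorem frobeniusTrace_cm11_three :
    (haveI := P2.OddHeegnerTwists.isGloballyMinimal_cm11; cm11.frobeniusTrace 3) = -1 := by
  haveI : cm11.IsGloballyMinimal := P2.OddHeegnerTwists.isGloballyMinimal_cm11
  rw [IntModel.frobeniusTrace_eq P2.OddHeegnerTwists.integralModelInt_cm11 KenkuLevelsCert.card_E11_jm32768_3]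
  norm_num

/-- `a₅(361a1) = −1`. [cite: Cremona1997, Table 1 (361a1)] -/
theorem frobeniusTrace_cm19_five :
    (haveI := P2.OddHeegnerTwists.isGloballyMinimal_cm19; cm19.frobeniusTrace 5) = -1 := by
  haveI : cm19.IsGloballyMinimal := P2.OddHeegnerTwists.isGloballyMinimal_cm19
  rw [IntModel.frobeniusTrace_eq P2.OddHeegnerTwists.integralModelInt_cm19 KenkuLevelsCert.card_E19_jm884736_5]
  norm_num

/-- `a₁₁(1849a1) = −1`. [cite: Cremona1997, Table 1 (1849a1)] -/
theorem frobeniusTrace_cm43_eleven :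
    (haveI := P2.OddHeegnerTwists.isGloballyMinimal_cm43; cm43.frobeniusTrace 11) = -1 := by
  haveI : cm43.IsGloballyMinimal := P2.OddHeegnerTwists.isGloballyMinimal_cm43
  rw [IntModel.frobeniusTrace_eq P2.OddHeegnerTwists.integralModelInt_cm43 KenkuLevelsCert.card_E43_jm884736000_11]
  norm_num

/-- `a₁₇(4489a1) = −1`. [cite: Cremona1997, Table 1 (4489a1)] -/
theorem frobeniusTrace_cm67_seventeen :
    (haveI := P2.OddHeegnerTwists.isGloballyMinimal_cm67; cm67.frobeniusTrace 17) = -1 := by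
  haveI : cm67.IsGloballyMinimal := P2.OddHeegnerTwists.isGloballyMinimal_cm67
  rw [IntModel.frobeniusTrace_eq P2.OddHeegnerTwists.integralModelInt_cm67 KenkuLevelsCert.card_E67_jm147197952000_17]
  norm_num

/-- `a₄₁(26569a1) = −1`. [cite: Cremona1997, Table 1 (26569a1)] -/
theorem frobeniusTrace_cm163_fortyone :
    (haveI := P2.OddHeegnerTwists.isGloballyMinimal_cm163; cm163.frobeniusTrace 41) = -1 := by
  haveI : cm163.IsGloballyMinimal := P2.OddHeegnerTwists.isGloballyMinimal_cm163
  rw [IntModel.frobeniusTrace_eq P2.OddHeegnerTwists.integralModelInt_cm163 KenkuLevelsCert.card_E163_jm262537412640768000_41]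
  norm_num

end LeafData

/-! ## §2 The non-scalar Frobenius fixing `√−p`, for every member of the class -/

section Leaf

variable (p : ℕ) [hp : Fact p.Prime]

/-- **Engine.** For a globally minimal elliptic `E₀/ℚ`, a prime `p`, an odd prime `q ≠ p` of good
reduction with `−p` a square mod `q` and `p² ∤ a_q(E₀)² − 4q`, and any `s = √−p ∈ ℚ̄`: an arithmetic
Frobenius `σ` at a prime above `q` fixes `s` (`DeuringLadic.smul_eq_self_of_isArithFrobAt`) and is
non-scalar on `E₀[p]` (`exists_smul_ne_of_not_sq_dvd`). [cite: SilvermanAEC2009, C.21 Remark 21.3 (tr ρ(φ_v) = a_v, det = q_v)] -/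
theorem exists_frobenius_nonScalar_of_data (E₀ : WeierstrassCurve ℚ) [E₀.IsElliptic] [E₀.IsGloballyMinimal]
    {q : ℕ} [hq' : Fact q.Prime] (hq2 : q ≠ 2) (hqp : q ≠ p) (hgood : E₀.HasGoodReductionAtPrime q)
    (hsq : IsSquare ((-(p : ℤ) : ℤ) : ZMod q))
    (hnd : ¬ ((p : ℤ) ^ 2) ∣ E₀.frobeniusTrace q ^ 2 - 4 * q)
    {s : AlgebraicClosure ℚ} (hs : s ^ 2 = ((-(p : ℤ) : ℤ) : AlgebraicClosure ℚ)) :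
    ∃ σ : absoluteGaloisGroup ℚ, σ • s = s ∧ ∀ c : ℤ, ∃ Q : geomTorsion E₀ p, σ • Q ≠ c • Q := by
  have hq : q.Prime := hq'.out
  obtain ⟨v, hv⟩ : ∃ v : HeightOneSpectrum (𝓞 ℚ), (primesEquiv v : ℕ) = q :=
    ⟨primesEquiv.symm ⟨q, hq⟩, by rw [Equiv.apply_symm_apply]⟩
  obtain ⟨𝔓, h𝔓⟩ := HeightOneSpectrum.primesAbove_nonempty v
  obtain ⟨σ, hσ⟩ := HeightOneSpectrum.exists_isArithFrobAt_of_mem_primesAbove_holds h𝔓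
  have hpd : ¬ (q : ℤ) ∣ (-(p : ℤ)) := by
    intro h
    rw [dvd_neg] at h
    have h' : q ∣ p := by exact_mod_cast h
    exact hqp ((Nat.prime_dvd_prime_iff_eq hq hp.out).mp h')
  refine ⟨σ, DeuringLadic.smul_eq_self_of_isArithFrobAt hq hq2 hpd hsq hs hv h𝔓 hσ, ?_⟩
  exact exists_smul_ne_of_not_sq_dvd E₀ p hqp hgood hv h𝔓 hσ hnd

/-- **Same `j`.** Non-scalarity of `σ` on `E₀[n]` passes to every `W` with `j(W) = j(E₀)`, through a short
model `E` (`a₁ = a₃ = 0`, `j ≠ 0, 1728`) and the tree's `ℚ̄`-isomorphisms `W ≅ E`, `E₀ ≅ E` commuting with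
`Γ_ℚ` up to sign (`DeuringLadic.exists_iso_of_j_eq`). [cite: SilvermanAEC2009, X.5 Prop. 5.4 and Cor. 5.4.1] -/
theorem exists_smul_ne_of_j_eq {W E₀ E : WeierstrassCurve ℚ} [W.IsElliptic] [E₀.IsElliptic] [E.IsElliptic]
    (n : ℤ) (hjW : W.j = E.j) (hj₀ : E₀.j = E.j) (h0 : E.j ≠ 0) (h1728 : E.j ≠ 1728) (ha₁ : E.a₁ = 0)
    (ha₃ : E.a₃ = 0) {σ : absoluteGaloisGroup ℚ} (h₀ : ∀ c : ℤ, ∃ Q : geomTorsion E₀ n, σ • Q ≠ c • Q)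
    (c : ℤ) : ∃ Q : geomTorsion W n, σ • Q ≠ c • Q := by
  obtain ⟨ι₁, hι₁⟩ := DeuringLadic.exists_iso_of_j_eq hjW h0 h1728 ha₁ ha₃
  obtain ⟨ι₀, hι₀⟩ := DeuringLadic.exists_iso_of_j_eq hj₀ h0 h1728 ha₁ ha₃
  exact exists_smul_ne_of_addEquiv n ι₁ (hι₁ σ) (exists_smul_ne_of_addEquiv_symm n ι₀ (hι₀ σ) h₀) c

/-- **The non-scalar Frobenius on the leaf.** For every elliptic `W/ℚ` with CM, every prime `p ≥ 5`
ramified in the CM field (`p ∈ {7, 11, 19, 43, 67, 163}`, seven `j`) and every `s = √−p ∈ ℚ̄`: some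
`σ ∈ Γ_ℚ` FIXES `s` and acts NON-SCALARLY on `W[p]`. (So `ρ̄_{W,p}(Γ_{ℚ(√−p)}) ⊄ 𝔽_pˣ`: the Borel
image has a non-trivial unipotent part, and `W[p]` is a non-semisimple `Γ_ℚ`-module.) The `σ` is an
arithmetic Frobenius at `q = 11, 11, 3, 5, 11, 17, 41` of the base curve of the class.
[cite: Cremona1997, Table 1 (49a1, 49a, 121b1, 361a1, 1849a1, 4489a1, 26569a1)] [cite: SilvermanAEC2009, C.21 Remark 21.3 (tr ρ(φ_v) = a_v, det = q_v)] -/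
theorem exists_frobenius_nonScalar_of_cmRamified (W : WeierstrassCurve ℚ) [W.IsElliptic]
    (hCM : W.HasCM) (h5 : 5 ≤ p) (hram : CMRamified W p)
    {s : AlgebraicClosure ℚ} (hs : s ^ 2 = ((-(p : ℤ) : ℤ) : AlgebraicClosure ℚ)) :
    ∃ σ : absoluteGaloisGroup ℚ, σ • s = s ∧ ∀ c : ℤ, ∃ Q : W.geomTorsion (p : ℤ), σ • Q ≠ c • Q := by
  haveI : Fact (Nat.Prime 3) := ⟨by norm_num⟩
  haveI : Fact (Nat.Prime 5) := ⟨by norm_num⟩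
  haveI : Fact (Nat.Prime 11) := ⟨by norm_num⟩
  haveI : Fact (Nat.Prime 17) := ⟨by norm_num⟩
  haveI : Fact (Nat.Prime 41) := ⟨by norm_num⟩
  have hcls := AnchorReduction.classes_of_cmRamified W hp.out hCM hram h5
  rcases hcls with ⟨rfl, hj | hj⟩ | ⟨rfl, hj⟩ | ⟨rfl, hj⟩ | ⟨rfl, hj⟩ | ⟨rfl, hj⟩ | ⟨rfl, hj⟩
  · -- p = 7, j = -3375: base 49a1, q = 11, short model of `cert7`
    haveI : cm7.IsGloballyMinimal := RouteU.isGloballyMinimal_X049_eq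
    haveI := isElliptic_cert7
    have hjE : (⟨0, 0, 0, -2835, -71442⟩ : WeierstrassCurve ℚ).j = -3375 := j_cert7 rfl
    obtain ⟨σ, hσs, hσ⟩ := exists_frobenius_nonScalar_of_data 7 cm7 (q := 11) (by norm_num)
      (by norm_num) (RouteU.hasGoodReductionAtPrime_cm7 11 (by norm_num)) ⟨2, by decide +revert⟩
      (by rw [frobeniusTrace_cm7_eleven]; norm_num) hs
    exact ⟨σ, hσs, exists_smul_ne_of_j_eq (E := ⟨0, 0, 0, -2835, -71442⟩) (7 : ℕ) (by rw [hj, hjE])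
      (by rw [j_cm7, hjE]) (by rw [hjE]; norm_num) (by rw [hjE]; norm_num) rfl rfl hσ⟩
  · -- p = 7, j = 16581375: base [1,-1,0,-37,-78] (N = 49), q = 11, short model of `cert28`
    haveI := EtaUncongruentRecords.isElliptic_A7b
    haveI : (⟨1, -1, 0, -37, -78⟩ : WeierstrassCurve ℚ).IsGloballyMinimal := EtaUncongruentRecords.isGloballyMinimal_A7b
    haveI := isElliptic_cert28
    have hjE : (⟨0, 0, 0, -48195, -4072194⟩ : WeierstrassCurve ℚ).j = 16581375 := j_cert28 rfl
    obtain ⟨σ, hσs, hσ⟩ := exists_frobenius_nonScalar_of_data 7 (⟨1, -1, 0, -37, -78⟩ : WeierstrassCurve ℚ)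
      (q := 11) (by norm_num) (by norm_num) (hasGoodReductionAtPrime_A7b 11 (by norm_num))
      ⟨2, by decide +revert⟩ (by rw [frobeniusTrace_A7b_eleven]; norm_num) hs
    exact ⟨σ, hσs, exists_smul_ne_of_j_eq (E := ⟨0, 0, 0, -48195, -4072194⟩) (7 : ℕ) (by rw [hj, hjE])
      (by rw [EtaUncongruentRecords.j_A7b, hjE]) (by rw [hjE]; norm_num) (by rw [hjE]; norm_num) rfl rfl hσ⟩
  · -- p = 11, j = -32768: base 121b1, q = 3, short model of `cert11`
    haveI : cm11.IsGloballyMinimal := P2.OddHeegnerTwists.isGloballyMinimal_cm11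
    haveI := isElliptic_cert11
    have hjE : (⟨0, 0, 0, -9504, 365904⟩ : WeierstrassCurve ℚ).j = -32768 := j_cert11 rfl
    obtain ⟨σ, hσs, hσ⟩ := exists_frobenius_nonScalar_of_data 11 cm11 (q := 3) (by norm_num)
      (by norm_num) (EisensteinTraceForm.hasGoodReductionAtPrime_cm11 3 (by norm_num)) ⟨1, by decide +revert⟩
      (by rw [frobeniusTrace_cm11_three]; norm_num) hs
    exact ⟨σ, hσs, exists_smul_ne_of_j_eq (E := ⟨0, 0, 0, -9504, 365904⟩) (11 : ℕ) (by rw [hj, hjE])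
      (by rw [j_cm11, hjE]) (by rw [hjE]; norm_num) (by rw [hjE]; norm_num) rfl rfl hσ⟩
  · -- p = 19, j = -884736: base 361a1, q = 5, short model of `cert19`
    haveI : cm19.IsGloballyMinimal := P2.OddHeegnerTwists.isGloballyMinimal_cm19
    haveI := isElliptic_cert19
    have hjE : (⟨0, 0, 0, -608, 5776⟩ : WeierstrassCurve ℚ).j = -884736 := j_cert19 rfl
    obtain ⟨σ, hσs, hσ⟩ := exists_frobenius_nonScalar_of_data 19 cm19 (q := 5) (by norm_num)
      (by norm_num) (EisensteinTraceForm.hasGoodReductionAtPrime_cm19 5 (by norm_num)) ⟨1, by decide +revert⟩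
      (by rw [frobeniusTrace_cm19_five]; norm_num) hs
    exact ⟨σ, hσs, exists_smul_ne_of_j_eq (E := ⟨0, 0, 0, -608, 5776⟩) (19 : ℕ) (by rw [hj, hjE])
      (by rw [j_cm19, hjE]) (by rw [hjE]; norm_num) (by rw [hjE]; norm_num) rfl rfl hσ⟩
  · -- p = 43, j = -884736000: base 1849a1, q = 11, short model of `cert43`
    haveI : cm43.IsGloballyMinimal := P2.OddHeegnerTwists.isGloballyMinimal_cm43
    haveI := isElliptic_cert43
    have hjE : (⟨0, 0, 0, -13760, 621264⟩ : WeierstrassCurve ℚ).j = -884736000 := j_cert43 rfl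
    obtain ⟨σ, hσs, hσ⟩ := exists_frobenius_nonScalar_of_data 43 cm43 (q := 11) (by norm_num)
      (by norm_num) (EisensteinTraceForm.hasGoodReductionAtPrime_cm43 11 (by norm_num)) ⟨1, by decide +revert⟩
      (by rw [frobeniusTrace_cm43_eleven]; norm_num) hs
    exact ⟨σ, hσs, exists_smul_ne_of_j_eq (E := ⟨0, 0, 0, -13760, 621264⟩) (43 : ℕ) (by rw [hj, hjE])
      (by rw [j_cm43, hjE]) (by rw [hjE]; norm_num) (by rw [hjE]; norm_num) rfl rfl hσ⟩
  · -- p = 67, j = -147197952000: base 4489a1, q = 17, short model of `cert67`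
    haveI : cm67.IsGloballyMinimal := P2.OddHeegnerTwists.isGloballyMinimal_cm67
    haveI := isElliptic_cert67
    have hjE : (⟨0, 0, 0, -117920, 15585808⟩ : WeierstrassCurve ℚ).j = -147197952000 := j_cert67 rfl
    obtain ⟨σ, hσs, hσ⟩ := exists_frobenius_nonScalar_of_data 67 cm67 (q := 17) (by norm_num)
      (by norm_num) (EisensteinTraceForm.hasGoodReductionAtPrime_cm67 17 (by norm_num)) ⟨1, by decide +revert⟩
      (by rw [frobeniusTrace_cm67_seventeen]; norm_num) hs
    exact ⟨σ, hσs, exists_smul_ne_of_j_eq (E := ⟨0, 0, 0, -117920, 15585808⟩) (67 : ℕ) (by rw [hj, hjE])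
      (by rw [j_cm67, hjE]) (by rw [hjE]; norm_num) (by rw [hjE]; norm_num) rfl rfl hσ⟩
  · -- p = 163, j = -262537412640768000: base 26569a1, q = 41, short model of `cert163`
    haveI : cm163.IsGloballyMinimal := P2.OddHeegnerTwists.isGloballyMinimal_cm163
    haveI := isElliptic_cert163
    have hjE : (⟨0, 0, 0, -34790720, 78984748304⟩ : WeierstrassCurve ℚ).j = -262537412640768000 :=
      j_cert163 rfl
    obtain ⟨σ, hσs, hσ⟩ := exists_frobenius_nonScalar_of_data 163 cm163 (q := 41) (by norm_num)
      (by norm_num) (AnchorReduction.hasGoodReductionAtPrime_cm163 41 (by norm_num)) ⟨1, by decide +revert⟩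
      (by rw [frobeniusTrace_cm163_fortyone]; norm_num) hs
    exact ⟨σ, hσs, exists_smul_ne_of_j_eq (E := ⟨0, 0, 0, -34790720, 78984748304⟩) (163 : ℕ)
      (by rw [hj, hjE]) (by rw [j_cm163, hjE]) (by rw [hjE]; norm_num) (by rw [hjE]; norm_num) rfl rfl hσ⟩

end Leaf

end Summit.BirchSwinnertonDyer.BirchSwinnertonDyer.Theorems.PrintCFram.BorelNonScalar
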